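import Literature.NumberTheory.CubicFields.DavenportBoundPosFibers
import HarnessLib

/-!
# Davenport's bound, positive discriminant: the pairs `(b, c)` for fixed `a`

`Proofs` file (theorems only), topic `Literature/NumberTheory/CubicFields`, continuing
`DavenportBoundPosFibers.lean`: for fixed `a ≠ 0`, the number of pairs `(b, c)` that extend to a
Hessian-reduced integral form `(a, b, c, d)` with `0 < Disc < X` is `O(√X)` uniformly in `a`
(`ncard_bcPairs_le`).  With `P = b² − 3ac`, `B = |b| − 3|a|/2`, `B' = |b| + 3|a|/2` and `t⁶ = 27a²X/4`:
reducedness gives `B² ≤ P` (when `B ≥ 0`) and `P < √X`; and when `4P³ > 27a²X` the discriminant window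
forces `√P − 27a²X/(4P^{5/2}) < B'` (`reduced_facts`), so that for fixed `b` the admissible `P` — an
arithmetic progression of difference `3|a|` in `c` — lie in an interval of length
`≤ max(t², (B' + w_b)²) − B₊²` with `w_b = t` for `B ≤ t` and `w_b = t⁶/B⁵` for `B > t`; summing over `b`
(a convergent `Σ B⁻⁴`) gives `O(√X)`.  (Davenport 1951 obtains the asymptotic count with error
`O(X^{15/16})`; Belabas 1997 §5 the `O(X)` running time of the enumeration of reduced forms.)

## References

* H. Davenport, *On the class-number of binary cubic forms I*, J. London Math. Soc. 26 (1951)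
  183–192 [Davenport1951CubicFormsI].
* K. Belabas, *A fast algorithm to compute cubic fields*, Math. Comp. 66 (1997), §§3, 5 [Belabas1997].
-/

noncomputable section

namespace Literature.NumberTheory.CubicFields

namespace BinaryCubic

open Finset

/-! ### Facts about a reduced form, in real terms -/

/-- **Inequalities satisfied by a Hessian-reduced form with `0 < Disc < X`** (real form): with
`α = |a|`, `P = b² − 3ac`: `0 < P`, `27α² ≤ 4P`, `P² < X`, `(2|b| − 3α)² ≤ 4P`, and the discriminant
window: if `27α²X < 4P³` then `√P − 27α²X/(4P²√P) < |b| + 3α/2`. [cite: Davenport1951CubicFormsI, Lemma 1] -/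
theorem reduced_facts {a b c d : ℤ} (ha : a ≠ 0) {X : ℕ}
    (hP : 0 < (BinaryCubic.mk a b c d).hessP) (hQ : |(BinaryCubic.mk a b c d).hessQ| ≤ (BinaryCubic.mk a b c d).hessP)
    (hR : (BinaryCubic.mk a b c d).hessP ≤ (BinaryCubic.mk a b c d).hessR)
    (hD : 0 < (BinaryCubic.mk a b c d).disc) (hDX : (BinaryCubic.mk a b c d).disc < X) :
    let P : ℝ := (b : ℝ) ^ 2 - 3 * a * c
    0 < P ∧ 27 * |(a : ℝ)| ^ 2 ≤ 4 * P ∧ P ^ 2 < X ∧ (2 * |(b : ℝ)| - 3 * |(a : ℝ)|) ^ 2 ≤ 4 * P ∧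
      (27 * |(a : ℝ)| ^ 2 * X < 4 * P ^ 3 →
        Real.sqrt P - 27 * |(a : ℝ)| ^ 2 * X / (4 * P ^ 2 * Real.sqrt P) < |(b : ℝ)| + 3 * |(a : ℝ)| / 2) := by
  intro P
  set f : BinaryCubic ℤ := BinaryCubic.mk a b c d with hf
  have hPz : (f.hessP : ℝ) = P := by simp [hf, hessP]; ring
  have hP0 : 0 < P := by rw [← hPz]; exact_mod_cast hP
  have h27z := sq_a_le_of_reduced hP hQ hR
  have h27 : 27 * |(a : ℝ)| ^ 2 ≤ 4 * P := by
    rw [sq_abs, ← hPz]; exact_mod_cast h27z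
  have hPX : P ^ 2 < X := by
    have h1 := hessP_sq_le_disc hQ hR hP.le
    have h2 : ((f.hessP ^ 2 : ℤ) : ℝ) < ((X : ℤ) : ℝ) := by exact_mod_cast h1.trans_lt hDX
    push_cast at h2
    rwa [hPz] at h2
  have hb : (2 * |(b : ℝ)| - 3 * |(a : ℝ)|) ^ 2 ≤ 4 * P := by
    have h1 := sq_b_le_of_reduced hP hQ hR
    have h2 : (((2 * |b| - 3 * |a|) ^ 2 : ℤ) : ℝ) ≤ ((4 * f.hessP : ℤ) : ℝ) := by exact_mod_cast h1
    push_cast at h2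
    rwa [hPz] at h2
  refine ⟨hP0, h27, hPX, hb, fun hbig => ?_⟩
  -- the window: `W = 2bP − 3aQ`, `W² = 4P³ − 27a²D > 4P³ − 27a²X`, `|W| ≤ 2P(|b| + 3|a|/2)`
  set B' : ℝ := |(b : ℝ)| + 3 * |(a : ℝ)| / 2 with hB'
  have hB'0 : 0 ≤ B' := by positivity
  set W : ℝ := ((2 * f.b * f.hessP - 3 * f.a * f.hessQ : ℤ) : ℝ) with hW
  have hW2 : W ^ 2 = 4 * P ^ 3 - 27 * (a : ℝ) ^ 2 * (f.disc : ℝ) := by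
    have h1 := f.sq_two_b_hessP_sub
    have h2 : (((2 * f.b * f.hessP - 3 * f.a * f.hessQ) ^ 2 : ℤ) : ℝ) = ((4 * f.hessP ^ 3 - 27 * f.a ^ 2 * f.disc : ℤ) : ℝ) := by
      exact_mod_cast h1
    push_cast at h2
    rw [hPz] at h2
    rw [hW]; push_cast; rw [hPz, h2]
  have hWabs : |W| ≤ 2 * P * B' := by
    have hQ' : |(f.hessQ : ℝ)| ≤ P := by
      rw [← Int.cast_abs, ← hPz]; exact_mod_cast hQ
    rw [hW]; push_cast
    rw [hPz]
    have hfa : (f.a : ℝ) = a := by simp [hf]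
    have hfb : (f.b : ℝ) = b := by simp [hf]
    rw [hfa, hfb, hB']
    calc |2 * (b : ℝ) * P - 3 * a * (f.hessQ : ℝ)| ≤ |2 * (b : ℝ) * P| + |3 * a * (f.hessQ : ℝ)| := abs_sub _ _
      _ = 2 * |(b : ℝ)| * P + 3 * |(a : ℝ)| * |(f.hessQ : ℝ)| := by
          rw [abs_mul, abs_mul, abs_mul, abs_mul, abs_of_pos hP0]; norm_num
      _ ≤ 2 * |(b : ℝ)| * P + 3 * |(a : ℝ)| * P := by gcongr
      _ = 2 * P * (|(b : ℝ)| + 3 * |(a : ℝ)| / 2) := by ring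
  have hDX' : (f.disc : ℝ) < X := by exact_mod_cast hDX
  have ha0 : (a : ℝ) ≠ 0 := by exact_mod_cast ha
  have hapos : 0 < |(a : ℝ)| := abs_pos.mpr ha0
  have hX0 : (0 : ℝ) < X := by
    have : (0 : ℤ) < X := hD.trans hDX
    exact_mod_cast this
  have hL : 4 * P ^ 3 - 27 * |(a : ℝ)| ^ 2 * X < W ^ 2 := by
    rw [hW2, sq_abs]
    have : 27 * (a : ℝ) ^ 2 * (f.disc : ℝ) < 27 * (a : ℝ) ^ 2 * X :=
      mul_lt_mul_of_pos_left hDX' (by positivity)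
    linarith
  -- `4P²(P − B'²) < 27α²X`
  have hkey : 4 * P ^ 2 * (P - B' ^ 2) < 27 * |(a : ℝ)| ^ 2 * X := by
    have h1 : W ^ 2 ≤ (2 * P * B') ^ 2 := by
      rw [← sq_abs W]; exact pow_le_pow_left₀ (abs_nonneg W) hWabs 2
    nlinarith
  have hsP : Real.sqrt P ^ 2 = P := Real.sq_sqrt hP0.le
  have hsP0 : 0 < Real.sqrt P := Real.sqrt_pos.mpr hP0
  set s : ℝ := 27 * |(a : ℝ)| ^ 2 * X / (4 * P ^ 2 * Real.sqrt P) with hs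
  have hs0 : 0 < s := by rw [hs]; positivity
  by_cases hcase : Real.sqrt P ≤ B'
  · linarith
  · push Not at hcase
    -- `(√P − B')(√P + B') = P − B'² < 27α²X/(4P²)` and `√P + B' ≥ √P`
    have h1 : (Real.sqrt P - B') * (Real.sqrt P + B') < 27 * |(a : ℝ)| ^ 2 * X / (4 * P ^ 2) := by
      rw [lt_div_iff₀ (by positivity)]
      nlinarith [hsP]
    have h2 : Real.sqrt P - B' < s := by
      rw [hs, lt_div_iff₀ (by positivity)]
      have h3 : (Real.sqrt P - B') * (4 * P ^ 2 * Real.sqrt P) ≤ (Real.sqrt P - B') * (Real.sqrt P + B') * (4 * P ^ 2) := by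
        have : 0 ≤ Real.sqrt P - B' := by linarith
        nlinarith [mul_nonneg this hB'0, sq_nonneg P]
      have h4 : (Real.sqrt P - B') * (Real.sqrt P + B') * (4 * P ^ 2) < 27 * |(a : ℝ)| ^ 2 * X := by
        have := h1
        rw [lt_div_iff₀ (by positivity)] at this
        linarith
      linarith
    linarith

/-! ### The fibre in `c` for fixed `(a, b)` -/

/-- **The admissible `c` for fixed `(a, b)` lie in a `P`-interval.**  If `(a, b, c, d)` is Hessian-reduced
with `0 < Disc < X` then `B₊² ≤ P` (`B = |b| − 3|a|/2`) and `P ≤ U` for any `U` with: `t² ≤ U` and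
`(|b| + 3|a|/2 + w)² ≤ U`, where `t⁶ = 27a²X/4` and `w` bounds `27a²X/(4P²√P)` from above on `P ≥ max(t², B₊²)`.
Here in the form used twice below: the set of such `c` is contained in
`{c : L ≤ −3a·c + b² ≤ U}`. [cite: Davenport1951CubicFormsI, §3] -/
theorem cFibre_subset {a : ℤ} (ha : a ≠ 0) (b : ℤ) (X : ℕ) {t : ℝ} (ht : 0 < t)
    (ht6 : t ^ 6 = 27 * |(a : ℝ)| ^ 2 * X / 4) {L U w : ℝ}
    (hL : L ≤ 0 ∨ (0 ≤ 2 * |(b : ℝ)| - 3 * |(a : ℝ)| ∧ L ≤ (|(b : ℝ)| - 3 * |(a : ℝ)| / 2) ^ 2))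
    (hw : ∀ P : ℝ, t ^ 2 < P → L ≤ P → 27 * |(a : ℝ)| ^ 2 * X / (4 * P ^ 2 * Real.sqrt P) ≤ w)
    (hUt : t ^ 2 ≤ U) (hUw : (|(b : ℝ)| + 3 * |(a : ℝ)| / 2 + w) ^ 2 ≤ U) :
    {c : ℤ | ∃ d : ℤ, 0 < (BinaryCubic.mk a b c d).hessP ∧ |(BinaryCubic.mk a b c d).hessQ| ≤ (BinaryCubic.mk a b c d).hessP ∧
        (BinaryCubic.mk a b c d).hessP ≤ (BinaryCubic.mk a b c d).hessR ∧
        0 < (BinaryCubic.mk a b c d).disc ∧ (BinaryCubic.mk a b c d).disc < X} ⊆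
      {c : ℤ | L ≤ (((-3 * a) * c + b ^ 2 : ℤ) : ℝ) ∧ (((-3 * a) * c + b ^ 2 : ℤ) : ℝ) ≤ U} := by
  rintro c ⟨d, hP, hQ, hR, hD, hDX⟩
  obtain ⟨hP0, h27, hPX, hb, hwin⟩ := reduced_facts ha hP hQ hR hD hDX
  set P : ℝ := (b : ℝ) ^ 2 - 3 * a * c with hPdef
  have hcast : (((-3 * a) * c + b ^ 2 : ℤ) : ℝ) = P := by rw [hPdef]; push_cast; ring
  rw [Set.mem_setOf_eq, hcast]
  -- lower bound
  have hlow : L ≤ P := by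
    rcases hL with hL | ⟨hB0, hL⟩
    · linarith
    · refine hL.trans ?_
      nlinarith
  refine ⟨hlow, ?_⟩
  -- upper bound
  by_cases hPt : P ≤ t ^ 2
  · linarith
  · push Not at hPt
    have hbig : 27 * |(a : ℝ)| ^ 2 * X < 4 * P ^ 3 := by
      have : t ^ 6 < P ^ 3 := by
        calc t ^ 6 = (t ^ 2) ^ 3 := by ring
          _ < P ^ 3 := pow_lt_pow_left₀ hPt (by positivity) (by norm_num)
      linarith
    have h1 := hwin hbig
    have h2 := hw P hPt hlow
    have hsP0 : 0 ≤ Real.sqrt P := Real.sqrt_nonneg P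
    have h3 : Real.sqrt P < |(b : ℝ)| + 3 * |(a : ℝ)| / 2 + w := by linarith
    have h4 : Real.sqrt P ^ 2 < (|(b : ℝ)| + 3 * |(a : ℝ)| / 2 + w) ^ 2 :=
      pow_lt_pow_left₀ h3 hsP0 (by norm_num)
    rw [Real.sq_sqrt hP0.le] at h4
    linarith

/-- **Case `|b| ≤ t + 3|a|/2`: at most `(2t + 3|a|)²/(3|a|) + 1` admissible `c`.** [cite: Davenport1951CubicFormsI, §3] -/
theorem ncard_cFibre_le_of_small {a : ℤ} (ha : a ≠ 0) (b : ℤ) (X : ℕ) {t : ℝ} (ht : 0 < t)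
    (ht6 : t ^ 6 = 27 * |(a : ℝ)| ^ 2 * X / 4) (hb : |(b : ℝ)| ≤ t + 3 * |(a : ℝ)| / 2) :
    (({c : ℤ | ∃ d : ℤ, 0 < (BinaryCubic.mk a b c d).hessP ∧ |(BinaryCubic.mk a b c d).hessQ| ≤ (BinaryCubic.mk a b c d).hessP ∧
        (BinaryCubic.mk a b c d).hessP ≤ (BinaryCubic.mk a b c d).hessR ∧
        0 < (BinaryCubic.mk a b c d).disc ∧ (BinaryCubic.mk a b c d).disc < X}).ncard : ℝ) ≤
      (2 * t + 3 * |(a : ℝ)|) ^ 2 / (3 * |(a : ℝ)|) + 1 := by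
  have hapos : 0 < |(a : ℝ)| := abs_pos.mpr (by exact_mod_cast ha)
  have hk : (-3 * a : ℤ) ≠ 0 := by
    intro h; apply ha; linarith
  -- `w = t`: for `P > t²`, `27α²X/(4P²√P) = t⁶/(P²√P) < t⁶/t⁵ = t`
  have hw : ∀ P : ℝ, t ^ 2 < P → (0 : ℝ) ≤ P → 27 * |(a : ℝ)| ^ 2 * X / (4 * P ^ 2 * Real.sqrt P) ≤ t := by
    intro P hPt _
    have hP0 : 0 < P := lt_of_le_of_lt (by positivity) hPt
    have hsP : t < Real.sqrt P := by
      rw [← Real.sqrt_sq ht.le]; exact Real.sqrt_lt_sqrt (by positivity) hPt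
    have hsP0 : 0 < Real.sqrt P := by linarith
    rw [div_le_iff₀ (by positivity)]
    have h1 : 27 * |(a : ℝ)| ^ 2 * X = 4 * t ^ 6 := by linarith
    rw [h1]
    have h2 : t ^ 4 < P ^ 2 := by nlinarith
    have h3 : t ^ 6 < P ^ 2 * Real.sqrt P * t := by
      have := mul_lt_mul'' h2 hsP (by positivity) ht.le
      nlinarith
    nlinarith
  have hsub := cFibre_subset ha b X ht ht6 (L := 0) (U := (2 * t + 3 * |(a : ℝ)|) ^ 2) (w := t)
    (Or.inl le_rfl) hw (by nlinarith [hapos.le]) (by nlinarith [abs_nonneg (b : ℝ), hapos.le, ht.le])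
  calc (({c : ℤ | ∃ d : ℤ, 0 < (BinaryCubic.mk a b c d).hessP ∧ |(BinaryCubic.mk a b c d).hessQ| ≤ (BinaryCubic.mk a b c d).hessP ∧
        (BinaryCubic.mk a b c d).hessP ≤ (BinaryCubic.mk a b c d).hessR ∧
        0 < (BinaryCubic.mk a b c d).disc ∧ (BinaryCubic.mk a b c d).disc < X}).ncard : ℝ)
      ≤ (({c : ℤ | (0 : ℝ) ≤ (((-3 * a) * c + b ^ 2 : ℤ) : ℝ) ∧ (((-3 * a) * c + b ^ 2 : ℤ) : ℝ) ≤ (2 * t + 3 * |(a : ℝ)|) ^ 2}).ncard : ℝ) := by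
        exact_mod_cast Set.ncard_le_ncard hsub (finite_int_affine_mem_Icc hk _ _ _)
    _ ≤ max (((2 * t + 3 * |(a : ℝ)|) ^ 2 - 0) / |((-3 * a : ℤ) : ℝ)|) 0 + 1 := ncard_int_affine_mem_Icc_le hk _ _ _
    _ = (2 * t + 3 * |(a : ℝ)|) ^ 2 / (3 * |(a : ℝ)|) + 1 := by
        have habs : |((-3 * a : ℤ) : ℝ)| = 3 * |(a : ℝ)| := by
          push_cast; rw [abs_mul, abs_neg]; norm_num
        rw [habs, sub_zero, max_eq_left (by positivity)]

/-- **Case `|b| > t + 3|a|/2`: at most `3B + 3|a| + 1 + t⁶/(|a|B⁴) + t⁶/B⁵` admissible `c`**, `B = |b| − 3|a|/2`.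
[cite: Davenport1951CubicFormsI, §3] -/
theorem ncard_cFibre_le_of_large {a : ℤ} (ha : a ≠ 0) (b : ℤ) (X : ℕ) {t : ℝ} (ht : 0 < t)
    (ht6 : t ^ 6 = 27 * |(a : ℝ)| ^ 2 * X / 4) (hb : t + 3 * |(a : ℝ)| / 2 < |(b : ℝ)|) :
    (({c : ℤ | ∃ d : ℤ, 0 < (BinaryCubic.mk a b c d).hessP ∧ |(BinaryCubic.mk a b c d).hessQ| ≤ (BinaryCubic.mk a b c d).hessP ∧
        (BinaryCubic.mk a b c d).hessP ≤ (BinaryCubic.mk a b c d).hessR ∧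
        0 < (BinaryCubic.mk a b c d).disc ∧ (BinaryCubic.mk a b c d).disc < X}).ncard : ℝ) ≤
      3 * (|(b : ℝ)| - 3 * |(a : ℝ)| / 2) + 3 * |(a : ℝ)| + 1 +
        t ^ 6 / (|(a : ℝ)| * (|(b : ℝ)| - 3 * |(a : ℝ)| / 2) ^ 4) + t ^ 6 / (|(b : ℝ)| - 3 * |(a : ℝ)| / 2) ^ 5 := by
  have hapos : 0 < |(a : ℝ)| := abs_pos.mpr (by exact_mod_cast ha)
  have hk : (-3 * a : ℤ) ≠ 0 := by
    intro h; apply ha; linarith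
  set α : ℝ := |(a : ℝ)| with hα
  set B : ℝ := |(b : ℝ)| - 3 * α / 2 with hB
  have hBt : t < B := by rw [hB]; linarith
  have hB0 : 0 < B := ht.trans hBt
  set w : ℝ := t ^ 6 / B ^ 5 with hwdef
  have hw0 : 0 ≤ w := by positivity
  have hwt : w ≤ t := by
    rw [hwdef, div_le_iff₀ (by positivity)]
    have : t ^ 5 ≤ B ^ 5 := pow_le_pow_left₀ ht.le hBt.le 5
    nlinarith
  have hwB : w ≤ B := hwt.trans hBt.le
  -- `w` bounds `27α²X/(4P²√P) = t⁶/(P²√P)` for `P ≥ B²`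
  have hw : ∀ P : ℝ, t ^ 2 < P → B ^ 2 ≤ P → 27 * α ^ 2 * X / (4 * P ^ 2 * Real.sqrt P) ≤ w := by
    intro P hPt hPB
    have hP0 : 0 < P := lt_of_le_of_lt (by positivity) hPt
    have hsP : B ≤ Real.sqrt P := by
      rw [← Real.sqrt_sq hB0.le]; exact Real.sqrt_le_sqrt hPB
    have hsP0 : 0 < Real.sqrt P := by linarith
    rw [hwdef, div_le_div_iff₀ (by positivity) (by positivity)]
    have h1 : 27 * α ^ 2 * X = 4 * t ^ 6 := by rw [hα]; linarith
    rw [h1]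
    have h2 : B ^ 4 ≤ P ^ 2 := by nlinarith
    have h3 : B ^ 4 * B ≤ P ^ 2 * Real.sqrt P := mul_le_mul h2 hsP hB0.le (by positivity)
    have ht6pos : 0 < t ^ 6 := by positivity
    nlinarith
  have hsub := cFibre_subset ha b X ht ht6 (L := B ^ 2) (U := (|(b : ℝ)| + 3 * α / 2 + w) ^ 2) (w := w)
    (Or.inr ⟨by linarith, by rw [hB]⟩) hw
    (by nlinarith [abs_nonneg (b : ℝ)]) le_rfl
  calc (({c : ℤ | ∃ d : ℤ, 0 < (BinaryCubic.mk a b c d).hessP ∧ |(BinaryCubic.mk a b c d).hessQ| ≤ (BinaryCubic.mk a b c d).hessP ∧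
        (BinaryCubic.mk a b c d).hessP ≤ (BinaryCubic.mk a b c d).hessR ∧
        0 < (BinaryCubic.mk a b c d).disc ∧ (BinaryCubic.mk a b c d).disc < X}).ncard : ℝ)
      ≤ (({c : ℤ | B ^ 2 ≤ (((-3 * a) * c + b ^ 2 : ℤ) : ℝ) ∧ (((-3 * a) * c + b ^ 2 : ℤ) : ℝ) ≤ (|(b : ℝ)| + 3 * α / 2 + w) ^ 2}).ncard : ℝ) := by
        exact_mod_cast Set.ncard_le_ncard hsub (finite_int_affine_mem_Icc hk _ _ _)
    _ ≤ max (((|(b : ℝ)| + 3 * α / 2 + w) ^ 2 - B ^ 2) / |((-3 * a : ℤ) : ℝ)|) 0 + 1 :=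
        ncard_int_affine_mem_Icc_le hk _ _ _
    _ = (3 * α + w) * (2 * B + 3 * α + w) / (3 * α) + 1 := by
        have habs : |((-3 * a : ℤ) : ℝ)| = 3 * α := by
          rw [hα]; push_cast; rw [abs_mul, abs_neg]; norm_num
        have heq : (|(b : ℝ)| + 3 * α / 2 + w) ^ 2 - B ^ 2 = (3 * α + w) * (2 * B + 3 * α + w) := by
          rw [hB]; ring
        rw [habs, heq, max_eq_left (by positivity)]
    _ ≤ 3 * B + 3 * α + 1 + t ^ 6 / (α * B ^ 4) + t ^ 6 / B ^ 5 := by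
        -- `(3α + w)(2B + 3α + w) ≤ (3α + w) · 3(B + α)` and `w(B + α)/α = t⁶/(αB⁴) + t⁶/B⁵`
        have h1 : (3 * α + w) * (2 * B + 3 * α + w) / (3 * α) ≤ (3 * α + w) * (3 * (B + α)) / (3 * α) := by
          gcongr
          nlinarith
        have h2 : (3 * α + w) * (3 * (B + α)) / (3 * α) = 3 * B + 3 * α + t ^ 6 / (α * B ^ 4) + t ^ 6 / B ^ 5 := by
          rw [hwdef]
          field_simp
          ring
        linarith

/-! ### Summation helpers -/

/-- **Counting a set of pairs through its fibres**: if the first coordinates lie in the finite set `B`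
and the fibres over `B` are finite, then `#S ≤ Σ_{b ∈ B} #{c : (b, c) ∈ S}`. [folklore] -/
theorem ncard_le_sum_ncard_fibre {ι κ : Type*} (S : Set (ι × κ)) (B : Finset ι)
    (hB : ∀ p ∈ S, p.1 ∈ B) (hC : ∀ b ∈ B, {c : κ | (b, c) ∈ S}.Finite) :
    (S.ncard : ℝ) ≤ ∑ b ∈ B, (({c : κ | (b, c) ∈ S}).ncard : ℝ) := by
  classical
  have hS : S.Finite := by
    refine ((B.finite_toSet).biUnion fun b hb => ((hC b hb).image (Prod.mk b))).subset ?_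
    intro p hp
    rw [Set.mem_iUnion₂]
    exact ⟨p.1, hB p hp, ⟨p.2, hp, rfl⟩⟩
  rw [Set.ncard_eq_toFinset_card S hS,
    Finset.card_eq_sum_card_fiberwise (f := Prod.fst) (s := hS.toFinset) (t := B)
      (fun p hp => hB p (hS.mem_toFinset.mp hp))]
  push_cast
  refine Finset.sum_le_sum fun b hb => ?_
  rw [Set.ncard_eq_toFinset_card _ (hC b hb)]
  exact_mod_cast Finset.card_le_card_of_injOn Prod.snd
    (fun p hp => by
      rw [Finset.mem_coe, Finset.mem_filter, Set.Finite.mem_toFinset] at hp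
      rw [Set.Finite.coe_toFinset, Set.mem_setOf_eq, ← hp.2]
      exact hp.1)
    (fun p hp p' hp' h => by
      rw [Finset.mem_coe, Finset.mem_filter] at hp hp'
      exact Prod.ext (hp.2.trans hp'.2.symm) h)

/-- `1/(x+1)⁴ ≤ (1/3)(1/x³ − 1/(x+1)³)` for `x > 0`. [folklore] -/
theorem inv_pow_four_le_sub {x : ℝ} (hx : 0 < x) :
    ((x + 1) ^ 4)⁻¹ ≤ 3⁻¹ * ((x ^ 3)⁻¹ - ((x + 1) ^ 3)⁻¹) := by
  rw [show (3 : ℝ)⁻¹ * ((x ^ 3)⁻¹ - ((x + 1) ^ 3)⁻¹) = ((x + 1) ^ 3 - x ^ 3) / (3 * (x ^ 3 * (x + 1) ^ 3)) by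
    field_simp]
  rw [inv_eq_one_div, div_le_div_iff₀ (by positivity) (by positivity)]
  nlinarith [pow_pos hx 3, pow_pos hx 2, pow_pos (by linarith : (0 : ℝ) < x + 1) 3]

/-- **`Σ_{i<N} 1/(B₀ + i)⁴ ≤ 1/B₀⁴ + 1/(3B₀³)`** for `B₀ > 0` (telescoping). [folklore] -/
theorem sum_inv_pow_four_le {B₀ : ℝ} (hB₀ : 0 < B₀) (N : ℕ) :
    ∑ i ∈ Finset.range N, ((B₀ + i) ^ 4)⁻¹ ≤ (B₀ ^ 4)⁻¹ + (3 * B₀ ^ 3)⁻¹ := by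
  have htail : ∀ M : ℕ, ∑ i ∈ Finset.range M, ((B₀ + (i + 1 : ℕ)) ^ 4)⁻¹ ≤
      3⁻¹ * ((B₀ ^ 3)⁻¹ - ((B₀ + M) ^ 3)⁻¹) := by
    intro M
    induction M with
    | zero => simp
    | succ M ih =>
      rw [Finset.sum_range_succ]
      have hx : 0 < B₀ + M := by positivity
      have h := inv_pow_four_le_sub hx
      have heq : (B₀ + ((M + 1 : ℕ) : ℝ)) = B₀ + M + 1 := by push_cast; ring
      rw [heq]
      push_cast at ih ⊢
      linarith
  cases N with
  | zero => simp; positivity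
  | succ N =>
    rw [Finset.sum_range_succ']
    have h1 := htail N
    have h2 : ((B₀ + N) ^ 3)⁻¹ ≥ 0 := by positivity
    simp only [Nat.cast_zero, add_zero]
    have h3 : (3 : ℝ)⁻¹ * (B₀ ^ 3)⁻¹ = (3 * B₀ ^ 3)⁻¹ := by rw [mul_inv]
    nlinarith [h1, h2, h3]

/-! ### The pairs `(b, c)` for fixed `a` -/

/-- **A priori bounds on `b` and `c`** for a Hessian-reduced `(a, b, c, d)` with `0 < Disc < X`:
`|b| ≤ ⌊X^{1/4} + 3|a|/2⌋` and `|c| < ⌊X^{1/4} + 3|a|/2⌋² + X`. [cite: Davenport1951CubicFormsI, Lemma 1] -/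
theorem abs_b_le_abs_c_lt {a b c d : ℤ} (ha : a ≠ 0) {X : ℕ}
    (hP : 0 < (BinaryCubic.mk a b c d).hessP) (hQ : |(BinaryCubic.mk a b c d).hessQ| ≤ (BinaryCubic.mk a b c d).hessP)
    (hR : (BinaryCubic.mk a b c d).hessP ≤ (BinaryCubic.mk a b c d).hessR)
    (hD : 0 < (BinaryCubic.mk a b c d).disc) (hDX : (BinaryCubic.mk a b c d).disc < X) :
    |b| ≤ ⌊Real.sqrt (Real.sqrt X) + 3 * |(a : ℝ)| / 2⌋ ∧
      |c| < ⌊Real.sqrt (Real.sqrt X) + 3 * |(a : ℝ)| / 2⌋ ^ 2 + X := by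
  obtain ⟨hP0, -, hPX, hb4, -⟩ := reduced_facts ha hP hQ hR hD hDX
  set q : ℝ := Real.sqrt (Real.sqrt X) with hq
  set α : ℝ := |(a : ℝ)| with hα
  set P : ℝ := (b : ℝ) ^ 2 - 3 * a * c with hPdef
  have hX0 : (0 : ℝ) ≤ X := by positivity
  have hq2 : q ^ 2 = Real.sqrt X := Real.sq_sqrt (Real.sqrt_nonneg _)
  have hPq : P < q ^ 2 := by
    rw [hq2]
    have : P ^ 2 < Real.sqrt (X : ℝ) ^ 2 := by rw [Real.sq_sqrt hX0]; exact hPX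
    exact lt_of_pow_lt_pow_left₀ 2 (Real.sqrt_nonneg _) this
  have hsP : Real.sqrt P < q := by
    rw [← Real.sqrt_sq (by positivity : (0:ℝ) ≤ q)]
    exact Real.sqrt_lt_sqrt hP0.le hPq
  have hbq : |(b : ℝ)| < q + 3 * α / 2 := by
    rcases le_or_gt (2 * |(b : ℝ)| - 3 * α) 0 with h0 | h0
    · nlinarith [abs_nonneg (b : ℝ), Real.sqrt_nonneg (Real.sqrt (X : ℝ)), abs_nonneg (a : ℝ)]
    · have h1 : 2 * |(b : ℝ)| - 3 * α ≤ Real.sqrt (4 * P) := Real.le_sqrt_of_sq_le hb4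
      have h2 : Real.sqrt (4 * P) = 2 * Real.sqrt P := by
        rw [Real.sqrt_mul (by norm_num), show Real.sqrt 4 = 2 by
          rw [show (4 : ℝ) = 2 ^ 2 by norm_num, Real.sqrt_sq (by norm_num)]]
      rw [h2] at h1
      linarith
  have hb1 : |b| ≤ ⌊q + 3 * α / 2⌋ := by
    rw [Int.le_floor, Int.cast_abs]; exact hbq.le
  refine ⟨hb1, ?_⟩
  have hPz : (BinaryCubic.mk a b c d).hessP = b ^ 2 - 3 * a * c := rfl
  have hP1 : 0 < b ^ 2 - 3 * a * c := hPz ▸ hP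
  have hP2 : b ^ 2 - 3 * a * c < X := by
    have h1 := hessP_sq_le_disc hQ hR hP.le
    rw [hPz] at h1
    have h2 : (b ^ 2 - 3 * a * c) ≤ (b ^ 2 - 3 * a * c) ^ 2 := by nlinarith
    exact (h2.trans h1).trans_lt hDX
  have hc3 : |c| ≤ |3 * a * c| := by
    rw [abs_mul, abs_mul, abs_of_pos (by norm_num : (0:ℤ) < 3)]
    have := Int.one_le_abs ha
    nlinarith [abs_nonneg c]
  have hc4 : |3 * a * c| < b ^ 2 + X := by
    rw [abs_lt]; constructor <;> nlinarith
  have hb2 : b ^ 2 ≤ ⌊q + 3 * α / 2⌋ ^ 2 := by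
    have := pow_le_pow_left₀ (abs_nonneg b) hb1 2
    rwa [sq_abs] at this
  calc |c| ≤ |3 * a * c| := hc3
    _ < b ^ 2 + X := hc4
    _ ≤ ⌊q + 3 * α / 2⌋ ^ 2 + X := by linarith

/-- **The block sum** `Σ_{i<K} F(n₁+1+i)` with `F(x) = 3(x − 3α/2) + 3α + 1 + t⁶/(α(x−3α/2)⁴) + t⁶/(x−3α/2)⁵`,
for `n₁ + 1 − 3α/2 > t` and `n₁ + 1 + i ≤ N` on the range, is at most
`N(3N + 3α + 1) + t²/α + t³/(3α) + t + t²/3`. [folklore] -/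
theorem blockSum_le {α t n₁ N : ℝ} (hα : 0 < α) (ht : 0 < t) (hB₀ : t < n₁ + 1 - 3 * α / 2)
    (K : ℕ) (hK : (K : ℝ) ≤ N) (hKmem : ∀ i ∈ Finset.range K, n₁ + 1 + (i : ℝ) ≤ N) :
    ∑ i ∈ Finset.range K, (3 * (n₁ + 1 + (i : ℝ) - 3 * α / 2) + 3 * α + 1 +
        t ^ 6 / (α * (n₁ + 1 + (i : ℝ) - 3 * α / 2) ^ 4) + t ^ 6 / (n₁ + 1 + (i : ℝ) - 3 * α / 2) ^ 5) ≤
      N * (3 * N + 3 * α + 1) + t ^ 2 / α + t ^ 3 / (3 * α) + t + t ^ 2 / 3 := by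
  set B₀ : ℝ := n₁ + 1 - 3 * α / 2 with hB₀def
  have hB₀0 : 0 < B₀ := ht.trans hB₀
  have hN : 0 ≤ N := le_trans (by positivity) hK
  have hterm : ∀ i ∈ Finset.range K, (3 * (n₁ + 1 + (i : ℝ) - 3 * α / 2) + 3 * α + 1 +
        t ^ 6 / (α * (n₁ + 1 + (i : ℝ) - 3 * α / 2) ^ 4) + t ^ 6 / (n₁ + 1 + (i : ℝ) - 3 * α / 2) ^ 5) ≤
      (3 * N + 3 * α + 1) + (t ^ 6 / α + t ^ 6 / t) * ((B₀ + i) ^ 4)⁻¹ := by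
    intro i hi
    have hi' := hKmem i hi
    have heq : n₁ + 1 + (i : ℝ) - 3 * α / 2 = B₀ + i := by rw [hB₀def]; ring
    rw [heq]
    have hBi : t < B₀ + i := by
      have : (0 : ℝ) ≤ i := by positivity
      linarith
    have hBi0 : 0 < B₀ + i := ht.trans hBi
    have h1 : 3 * (B₀ + i) ≤ 3 * N := by rw [hB₀def]; linarith
    have h2 : t ^ 6 / (α * (B₀ + i) ^ 4) = t ^ 6 / α * ((B₀ + i) ^ 4)⁻¹ := by
      field_simp
    have h3 : t ^ 6 / (B₀ + i) ^ 5 ≤ t ^ 6 / t * ((B₀ + i) ^ 4)⁻¹ := by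
      have e1 : t ^ 6 / t = t ^ 5 := by field_simp
      rw [e1, ← div_eq_mul_inv, div_le_div_iff₀ (by positivity) (by positivity)]
      have e2 : (B₀ + i) ^ 5 = (B₀ + i) ^ 4 * (B₀ + i) := by ring
      rw [e2]
      have : t ^ 6 * (B₀ + i) ^ 4 ≤ t ^ 5 * ((B₀ + i) ^ 4 * (B₀ + i)) := by
        have : t ^ 6 * (B₀ + i) ^ 4 = t ^ 5 * (B₀ + i) ^ 4 * t := by ring
        rw [this]
        have : t ^ 5 * ((B₀ + i) ^ 4 * (B₀ + i)) = t ^ 5 * (B₀ + i) ^ 4 * (B₀ + i) := by ring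
        rw [this]
        exact mul_le_mul_of_nonneg_left hBi.le (by positivity)
      linarith
    nlinarith [h2, h3]
  calc ∑ i ∈ Finset.range K, (3 * (n₁ + 1 + (i : ℝ) - 3 * α / 2) + 3 * α + 1 +
        t ^ 6 / (α * (n₁ + 1 + (i : ℝ) - 3 * α / 2) ^ 4) + t ^ 6 / (n₁ + 1 + (i : ℝ) - 3 * α / 2) ^ 5)
      ≤ ∑ i ∈ Finset.range K, ((3 * N + 3 * α + 1) + (t ^ 6 / α + t ^ 6 / t) * ((B₀ + i) ^ 4)⁻¹) :=
        Finset.sum_le_sum hterm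
    _ = K * (3 * N + 3 * α + 1) + (t ^ 6 / α + t ^ 6 / t) * ∑ i ∈ Finset.range K, ((B₀ + i) ^ 4)⁻¹ := by
        rw [Finset.sum_add_distrib, Finset.sum_const, Finset.card_range, nsmul_eq_mul, Finset.mul_sum]
    _ ≤ N * (3 * N + 3 * α + 1) + (t ^ 6 / α + t ^ 6 / t) * ((t ^ 4)⁻¹ + (3 * t ^ 3)⁻¹) := by
        gcongr
        calc ∑ i ∈ Finset.range K, ((B₀ + i) ^ 4)⁻¹ ≤ (B₀ ^ 4)⁻¹ + (3 * B₀ ^ 3)⁻¹ :=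
              sum_inv_pow_four_le hB₀0 K
          _ ≤ (t ^ 4)⁻¹ + (3 * t ^ 3)⁻¹ := by gcongr
    _ = N * (3 * N + 3 * α + 1) + t ^ 2 / α + t ^ 3 / (3 * α) + t + t ^ 2 / 3 := by
        field_simp
        ring

/-- **Numerical bookkeeping** for `ncard_bcPairs_le`. [folklore] -/
theorem pairs_numerics {α q r t n₁ N : ℝ} (hα1 : 1 ≤ α) (hq1 : 1 ≤ q) (hq2 : q ^ 2 = r)
    (hαq : α ≤ q / 2) (ht1 : 1 ≤ t) (htq : t ≤ q) (ht3 : t ^ 3 ≤ 13 / 5 * α * r)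
    (hn₁ : n₁ ≤ t + 3 * α / 2) (hN0 : 0 ≤ N) (hN : N ≤ q + 3 * α / 2) :
    (2 * n₁ + 1) * ((2 * t + 3 * α) ^ 2 / (3 * α) + 1) +
        2 * (N * (3 * N + 3 * α + 1) + t ^ 2 / α + t ^ 3 / (3 * α) + t + t ^ 2 / 3) ≤ 200 * r := by
  have hα : 0 < α := by linarith
  have ht0 : 0 < t := by linarith
  have hr1 : 1 ≤ r := by nlinarith
  have hqr : q ≤ r := by nlinarith
  have ht2r : t ^ 2 ≤ r := by nlinarith
  have hαr : α ≤ r / 2 := by linarith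
  have hφ0 : 0 ≤ (2 * t + 3 * α) ^ 2 / (3 * α) + 1 := by positivity
  have hA : (2 * n₁ + 1) * ((2 * t + 3 * α) ^ 2 / (3 * α) + 1) ≤ 42 * r := by
    have hnum : (2 * t + 3 * α + 1) * ((2 * t + 3 * α) ^ 2 + 3 * α) ≤ 125 * α * r := by
      have m1 : t ^ 2 * α ≤ r * α := mul_le_mul_of_nonneg_right ht2r hα.le
      have m2 : t * α ≤ r / 2 := by nlinarith
      have m3 : t * α ^ 2 ≤ r / 2 * α := by nlinarith
      have m4 : α ^ 2 ≤ r / 4 := by nlinarith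
      have m5 : α ^ 3 ≤ r / 4 * α := by nlinarith
      have m6 : t ^ 2 ≤ α * r := by nlinarith
      have m7 : t * α ≤ α * r := by nlinarith
      have m8 : α ^ 2 ≤ α * r / 2 := by nlinarith
      have m9 : α ≤ α * r := by nlinarith
      nlinarith [ht3, m1, m3, m5, m6, m7, m8, m9, ht0.le, hα.le]
    have heq : (2 * t + 3 * α + 1) * ((2 * t + 3 * α) ^ 2 / (3 * α) + 1) =
        (2 * t + 3 * α + 1) * ((2 * t + 3 * α) ^ 2 + 3 * α) / (3 * α) := by
      field_simp
    calc (2 * n₁ + 1) * ((2 * t + 3 * α) ^ 2 / (3 * α) + 1)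
        ≤ (2 * t + 3 * α + 1) * ((2 * t + 3 * α) ^ 2 / (3 * α) + 1) :=
          mul_le_mul_of_nonneg_right (by linarith) hφ0
      _ = (2 * t + 3 * α + 1) * ((2 * t + 3 * α) ^ 2 + 3 * α) / (3 * α) := heq
      _ ≤ 125 * α * r / (3 * α) := by gcongr
      _ = 125 / 3 * r := by field_simp
      _ ≤ 42 * r := by linarith
  have hB : 2 * (N * (3 * N + 3 * α + 1)) ≤ 28 * r := by
    rw [← hq2]
    have hN' : N ≤ 7 / 4 * q := by linarith
    nlinarith
  have hC : 2 * (t ^ 2 / α + t ^ 3 / (3 * α) + t + t ^ 2 / 3) ≤ 7 * r := by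
    have h1 : t ^ 2 / α ≤ t ^ 2 := div_le_self (by positivity) hα1
    have h2 : t ^ 3 / (3 * α) ≤ 13 / 15 * r := by
      rw [div_le_iff₀ (by positivity)]; nlinarith
    have h3 : t ≤ r := htq.trans hqr
    nlinarith
  linarith

/-- The set of pairs `(b, c)` extending to a Hessian-reduced `(a, b, c, d)` with `0 < Disc < X` is finite.
[folklore] -/
theorem bcPairs_finite {a : ℤ} (ha : a ≠ 0) (X : ℕ) :
    {p : ℤ × ℤ | ∃ d : ℤ, 0 < (BinaryCubic.mk a p.1 p.2 d).hessP ∧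
        |(BinaryCubic.mk a p.1 p.2 d).hessQ| ≤ (BinaryCubic.mk a p.1 p.2 d).hessP ∧
        (BinaryCubic.mk a p.1 p.2 d).hessP ≤ (BinaryCubic.mk a p.1 p.2 d).hessR ∧
        0 < (BinaryCubic.mk a p.1 p.2 d).disc ∧ (BinaryCubic.mk a p.1 p.2 d).disc < X}.Finite := by
  set Nb : ℤ := ⌊Real.sqrt (Real.sqrt X) + 3 * |(a : ℝ)| / 2⌋ with hNb
  refine (Finset.finite_toSet (Finset.Icc (-Nb) Nb ×ˢ Finset.Icc (-(Nb ^ 2 + X)) (Nb ^ 2 + X))).subset ?_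
  rintro ⟨b, c⟩ ⟨d, hP, hQ, hR, hD, hDX⟩
  obtain ⟨h1, h2⟩ := abs_b_le_abs_c_lt ha hP hQ hR hD hDX
  rw [Finset.coe_product, Set.mem_prod, Finset.coe_Icc, Finset.coe_Icc, Set.mem_Icc, Set.mem_Icc]
  exact ⟨abs_le.mp h1, ⟨(abs_lt.mp h2).1.le, (abs_lt.mp h2).2.le⟩⟩

/-- **The number of pairs `(b, c)` extending to a Hessian-reduced `(a, b, c, d)` with `0 < Disc < X` is
`≤ 200 √X`, uniformly in `a ≠ 0`.** [cite: Davenport1951CubicFormsI, §3] [cite: Belabas1997, §5] -/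
theorem ncard_bcPairs_le {a : ℤ} (ha : a ≠ 0) (X : ℕ) (hX : 1 ≤ X) :
    (({p : ℤ × ℤ | ∃ d : ℤ, 0 < (BinaryCubic.mk a p.1 p.2 d).hessP ∧
        |(BinaryCubic.mk a p.1 p.2 d).hessQ| ≤ (BinaryCubic.mk a p.1 p.2 d).hessP ∧
        (BinaryCubic.mk a p.1 p.2 d).hessP ≤ (BinaryCubic.mk a p.1 p.2 d).hessR ∧
        0 < (BinaryCubic.mk a p.1 p.2 d).disc ∧ (BinaryCubic.mk a p.1 p.2 d).disc < X}).ncard : ℝ) ≤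
      200 * Real.sqrt X := by
  classical
  set S : Set (ℤ × ℤ) := {p : ℤ × ℤ | ∃ d : ℤ, 0 < (BinaryCubic.mk a p.1 p.2 d).hessP ∧
        |(BinaryCubic.mk a p.1 p.2 d).hessQ| ≤ (BinaryCubic.mk a p.1 p.2 d).hessP ∧
        (BinaryCubic.mk a p.1 p.2 d).hessP ≤ (BinaryCubic.mk a p.1 p.2 d).hessR ∧
        0 < (BinaryCubic.mk a p.1 p.2 d).disc ∧ (BinaryCubic.mk a p.1 p.2 d).disc < X} with hSdef
  -- the basic real parameters
  set α : ℝ := |(a : ℝ)| with hα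
  have hapos : 0 < α := abs_pos.mpr (by exact_mod_cast ha)
  have hα1 : 1 ≤ α := by
    rw [hα, ← Int.cast_abs]; exact_mod_cast Int.one_le_abs ha
  have hX1 : (1 : ℝ) ≤ X := by exact_mod_cast hX
  set r : ℝ := Real.sqrt X with hr
  have hr1 : 1 ≤ r := by rw [hr]; exact Real.one_le_sqrt.mpr hX1
  have hr2 : r ^ 2 = X := Real.sq_sqrt (by positivity)
  set q : ℝ := Real.sqrt r with hq
  have hq1 : 1 ≤ q := by rw [hq]; exact Real.one_le_sqrt.mpr hr1
  have hq2 : q ^ 2 = r := Real.sq_sqrt (by positivity)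
  rcases S.eq_empty_or_nonempty with hempty | ⟨p₀, hp₀⟩
  · rw [hempty, Set.ncard_empty, Nat.cast_zero]; positivity
  -- a member: `27α² < 4 q²`
  have hαq : 27 * α ^ 2 < 4 * q ^ 2 := by
    obtain ⟨d₀, hP, hQ, hR, hD, hDX⟩ := hp₀
    obtain ⟨hP0, h27, hPX, -, -⟩ := reduced_facts ha hP hQ hR hD hDX
    have h1 : ((p₀.1 : ℝ) ^ 2 - 3 * a * p₀.2) ^ 2 < r ^ 2 := by rw [hr2]; exact hPX
    have h2 : (p₀.1 : ℝ) ^ 2 - 3 * a * p₀.2 < r := lt_of_pow_lt_pow_left₀ 2 (by positivity) h1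
    rw [hq2]; linarith
  have hαq' : α ≤ q / 2 := by nlinarith
  -- `t⁶ = 27α²X/4`
  set base : ℝ := 27 * α ^ 2 * X / 4 with hbase
  have hbase0 : 0 < base := by positivity
  set t : ℝ := base ^ ((6 : ℕ) : ℝ)⁻¹ with htdef
  have ht0 : 0 < t := Real.rpow_pos_of_pos hbase0 _
  have ht6 : t ^ 6 = base := Real.rpow_inv_natCast_pow hbase0.le (by norm_num)
  have ht6' : t ^ 6 = 27 * |(a : ℝ)| ^ 2 * X / 4 := by rw [ht6, hbase]
  have ht1 : 1 ≤ t := by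
    by_contra h
    push Not at h
    have : t ^ 6 < 1 := pow_lt_one₀ ht0.le h (by norm_num)
    have : (27 : ℝ) / 4 ≤ base := by rw [hbase]; nlinarith
    linarith
  have htq : t ≤ q := by
    have h1 : t ^ 6 ≤ q ^ 6 := by
      rw [ht6, hbase]
      have : (X : ℝ) = q ^ 4 := by rw [← hr2, ← hq2]; ring
      rw [this]; nlinarith [pow_pos (by positivity : (0:ℝ) < q) 4]
    exact le_of_pow_le_pow_left₀ (by norm_num) (by positivity) h1
  have ht3 : t ^ 3 ≤ 13 / 5 * α * r := by
    have h1 : (t ^ 3) ^ 2 ≤ (13 / 5 * α * r) ^ 2 := by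
      have : (t ^ 3) ^ 2 = t ^ 6 := by ring
      rw [this, ht6, hbase, ← hr2]; nlinarith [pow_pos hapos 2, pow_pos (by positivity : (0:ℝ) < r) 2]
    exact le_of_pow_le_pow_left₀ two_ne_zero (by positivity) h1
  -- every member has `|b| ≤ Nb` and `|c| < Nb² + X`
  set Nb : ℤ := ⌊q + 3 * α / 2⌋ with hNb
  have hNb0 : 0 ≤ Nb := by rw [hNb]; exact Int.floor_nonneg.mpr (by positivity)
  have hNbq : (Nb : ℝ) ≤ q + 3 * α / 2 := Int.floor_le _
  have hmemb : ∀ p ∈ S, |p.1| ≤ Nb ∧ |p.2| < Nb ^ 2 + X := by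
    rintro ⟨b, c⟩ ⟨d, hP, hQ, hR, hD, hDX⟩
    exact abs_b_le_abs_c_lt ha hP hQ hR hD hDX
  -- finiteness and the fibre decomposition
  have hSfin : S.Finite := bcPairs_finite ha X
  set s : Finset ℤ := Finset.Icc (-Nb) Nb with hsdef
  have hB : ∀ p ∈ S, p.1 ∈ s := fun p hp => by
    rw [hsdef, Finset.mem_Icc]; exact abs_le.mp (hmemb p hp).1
  have hfib := ncard_le_sum_ncard_fibre S s hB fun b _ =>
    hSfin.preimage (f := fun c : ℤ => (b, c)) fun x _ y _ h => (Prod.mk.inj h).2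
  -- the fibres `{c | (b, c) ∈ S}` are the `c`-fibres of the previous section
  simp only [hSdef, Set.mem_setOf_eq] at hfib
  -- the threshold `n₁ = ⌊t + 3α/2⌋`
  set n₁ : ℤ := ⌊t + 3 * α / 2⌋ with hn₁
  have hn₁0 : 0 ≤ n₁ := by rw [hn₁]; exact Int.floor_nonneg.mpr (by positivity)
  have hn₁le : (n₁ : ℝ) ≤ t + 3 * α / 2 := Int.floor_le _
  have hn₁lt : t + 3 * α / 2 < (n₁ : ℝ) + 1 := Int.lt_floor_add_one _
  -- the bounds on the fibres
  have hmid : ∀ b : ℤ, -n₁ ≤ b → b ≤ n₁ →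
      (({c : ℤ | ∃ d : ℤ, 0 < (BinaryCubic.mk a b c d).hessP ∧ |(BinaryCubic.mk a b c d).hessQ| ≤ (BinaryCubic.mk a b c d).hessP ∧
        (BinaryCubic.mk a b c d).hessP ≤ (BinaryCubic.mk a b c d).hessR ∧
        0 < (BinaryCubic.mk a b c d).disc ∧ (BinaryCubic.mk a b c d).disc < X}).ncard : ℝ) ≤
      (2 * t + 3 * α) ^ 2 / (3 * α) + 1 := by
    intro b hb1 hb2
    have hb : |(b : ℝ)| ≤ t + 3 * |(a : ℝ)| / 2 := by
      rw [← hα, abs_le]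
      constructor
      · have : ((-n₁ : ℤ) : ℝ) ≤ b := by exact_mod_cast hb1
        push_cast at this; linarith
      · have : (b : ℝ) ≤ n₁ := by exact_mod_cast hb2
        linarith
    exact ncard_cFibre_le_of_small ha b X ht0 ht6' hb
  have hout : ∀ b : ℤ, t + 3 * α / 2 < |(b : ℝ)| →
      (({c : ℤ | ∃ d : ℤ, 0 < (BinaryCubic.mk a b c d).hessP ∧ |(BinaryCubic.mk a b c d).hessQ| ≤ (BinaryCubic.mk a b c d).hessP ∧
        (BinaryCubic.mk a b c d).hessP ≤ (BinaryCubic.mk a b c d).hessR ∧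
        0 < (BinaryCubic.mk a b c d).disc ∧ (BinaryCubic.mk a b c d).disc < X}).ncard : ℝ) ≤
      3 * (|(b : ℝ)| - 3 * α / 2) + 3 * α + 1 + t ^ 6 / (α * (|(b : ℝ)| - 3 * α / 2) ^ 4) +
        t ^ 6 / (|(b : ℝ)| - 3 * α / 2) ^ 5 := by
    intro b hb
    exact ncard_cFibre_le_of_large ha b X ht0 ht6' hb
  -- splitting the sum over `s`
  set G : ℤ → ℝ := fun b => (({c : ℤ | ∃ d : ℤ, 0 < (BinaryCubic.mk a b c d).hessP ∧
        |(BinaryCubic.mk a b c d).hessQ| ≤ (BinaryCubic.mk a b c d).hessP ∧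
        (BinaryCubic.mk a b c d).hessP ≤ (BinaryCubic.mk a b c d).hessR ∧
        0 < (BinaryCubic.mk a b c d).disc ∧ (BinaryCubic.mk a b c d).disc < X}).ncard : ℝ) with hGdef
  have hG0 : ∀ b, 0 ≤ G b := fun b => by rw [hGdef]; positivity
  have hsplit : ∑ b ∈ s, G b =
      ∑ b ∈ s.filter (fun b => b < -n₁), G b + ∑ b ∈ s.filter (fun b => -n₁ ≤ b ∧ b ≤ n₁), G b +
        ∑ b ∈ s.filter (fun b => n₁ < b), G b := by
    rw [← Finset.sum_filter_add_sum_filter_not s (fun b => b < -n₁)]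
    rw [← Finset.sum_filter_add_sum_filter_not (s.filter fun b => ¬ b < -n₁) (fun b => b ≤ n₁)]
    rw [Finset.filter_filter, Finset.filter_filter, add_assoc]
    congr 2
    · apply Finset.sum_congr _ (fun _ _ => rfl)
      ext b; simp only [Finset.mem_filter, not_lt]
    · apply Finset.sum_congr _ (fun _ _ => rfl)
      ext b; simp only [Finset.mem_filter, not_lt, not_le]
      constructor
      · rintro ⟨h1, -, h3⟩; exact ⟨h1, h3⟩
      · rintro ⟨h1, h3⟩; exact ⟨h1, by omega, h3⟩
  -- the index range for the outer blocks
  set K : ℕ := (Nb - n₁).toNat with hK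
  have hKle : (K : ℝ) ≤ Nb := by
    have : (K : ℤ) ≤ Nb := by
      rw [hK]; rcases le_or_gt n₁ Nb with h | h
      · rw [Int.toNat_of_nonneg (by omega)]; omega
      · rw [Int.toNat_of_nonpos (by omega)]; exact_mod_cast hNb0
    exact_mod_cast this
  have hKmem : ∀ i ∈ Finset.range K, n₁ + 1 + (i : ℤ) ≤ Nb := by
    intro i hi
    rw [Finset.mem_range] at hi
    have : (i : ℤ) < (K : ℤ) := by exact_mod_cast hi
    rw [hK] at this
    rcases le_or_gt n₁ Nb with h | h
    · rw [Int.toNat_of_nonneg (by omega)] at this; omega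
    · rw [Int.toNat_of_nonpos (by omega)] at this; omega
  have hKmem' : ∀ i ∈ Finset.range K, (n₁ : ℝ) + 1 + (i : ℝ) ≤ Nb := fun i hi => by
    exact_mod_cast hKmem i hi
  have hblock := blockSum_le (N := (Nb : ℝ)) hapos ht0 (by linarith) K hKle hKmem'
  -- the three blocks
  set F : ℝ → ℝ := fun x => 3 * (x - 3 * α / 2) + 3 * α + 1 + t ^ 6 / (α * (x - 3 * α / 2) ^ 4) +
    t ^ 6 / (x - 3 * α / 2) ^ 5 with hFdef
  have hL : ∑ b ∈ s.filter (fun b => b < -n₁), G b ≤ ∑ i ∈ Finset.range K, F ((n₁ : ℝ) + 1 + i) := by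
    have hsub : s.filter (fun b => b < -n₁) ⊆ (Finset.range K).image (fun i : ℕ => -(n₁ + 1 + (i : ℤ))) := by
      intro b hb
      rw [Finset.mem_filter, hsdef, Finset.mem_Icc] at hb
      obtain ⟨⟨hb1, -⟩, hb2⟩ := hb
      rw [Finset.mem_image]
      refine ⟨(-b - n₁ - 1).toNat, ?_, ?_⟩
      · rw [Finset.mem_range]
        have : ((-b - n₁ - 1).toNat : ℤ) < K := by
          rw [Int.toNat_of_nonneg (by omega), hK, Int.toNat_of_nonneg (by omega)]; omega
        exact_mod_cast this
      · rw [Int.toNat_of_nonneg (by omega)]; ring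
    have hinj : Set.InjOn (fun i : ℕ => -(n₁ + 1 + (i : ℤ))) ↑(Finset.range K) := by
      intro i _ j _ h
      have : (n₁ + 1 + (i : ℤ)) = n₁ + 1 + (j : ℤ) := neg_inj.mp h
      exact_mod_cast (add_left_cancel this)
    calc ∑ b ∈ s.filter (fun b => b < -n₁), G b
        ≤ ∑ b ∈ (Finset.range K).image (fun i : ℕ => -(n₁ + 1 + (i : ℤ))), G b :=
          Finset.sum_le_sum_of_subset_of_nonneg hsub fun b _ _ => hG0 b
      _ = ∑ i ∈ Finset.range K, G (-(n₁ + 1 + (i : ℤ))) := Finset.sum_image hinj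
      _ ≤ ∑ i ∈ Finset.range K, F ((n₁ : ℝ) + 1 + i) := by
          refine Finset.sum_le_sum fun i _ => ?_
          have habs : |(((-(n₁ + 1 + (i : ℤ))) : ℤ) : ℝ)| = (n₁ : ℝ) + 1 + i := by
            push_cast
            rw [abs_neg]; exact abs_of_nonneg (by positivity)
          have h := hout (-(n₁ + 1 + (i : ℤ))) (by rw [habs]; linarith)
          rw [habs] at h
          exact h
  have hRt : ∑ b ∈ s.filter (fun b => n₁ < b), G b ≤ ∑ i ∈ Finset.range K, F ((n₁ : ℝ) + 1 + i) := by
    have hsub : s.filter (fun b => n₁ < b) ⊆ (Finset.range K).image (fun i : ℕ => n₁ + 1 + (i : ℤ)) := by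
      intro b hb
      rw [Finset.mem_filter, hsdef, Finset.mem_Icc] at hb
      obtain ⟨⟨-, hb1⟩, hb2⟩ := hb
      rw [Finset.mem_image]
      refine ⟨(b - n₁ - 1).toNat, ?_, ?_⟩
      · rw [Finset.mem_range]
        have : ((b - n₁ - 1).toNat : ℤ) < K := by
          rw [Int.toNat_of_nonneg (by omega), hK, Int.toNat_of_nonneg (by omega)]; omega
        exact_mod_cast this
      · rw [Int.toNat_of_nonneg (by omega)]; ring
    have hinj : Set.InjOn (fun i : ℕ => n₁ + 1 + (i : ℤ)) ↑(Finset.range K) := by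
      intro i _ j _ h
      exact_mod_cast (add_left_cancel h)
    calc ∑ b ∈ s.filter (fun b => n₁ < b), G b
        ≤ ∑ b ∈ (Finset.range K).image (fun i : ℕ => n₁ + 1 + (i : ℤ)), G b :=
          Finset.sum_le_sum_of_subset_of_nonneg hsub fun b _ _ => hG0 b
      _ = ∑ i ∈ Finset.range K, G (n₁ + 1 + (i : ℤ)) := Finset.sum_image hinj
      _ ≤ ∑ i ∈ Finset.range K, F ((n₁ : ℝ) + 1 + i) := by
          refine Finset.sum_le_sum fun i _ => ?_
          have habs : |(((n₁ + 1 + (i : ℤ)) : ℤ) : ℝ)| = (n₁ : ℝ) + 1 + i := by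
            push_cast
            exact abs_of_nonneg (by positivity)
          have h := hout (n₁ + 1 + (i : ℤ)) (by rw [habs]; linarith)
          rw [habs] at h
          exact h
  have hM : ∑ b ∈ s.filter (fun b => -n₁ ≤ b ∧ b ≤ n₁), G b ≤ (2 * n₁ + 1) * ((2 * t + 3 * α) ^ 2 / (3 * α) + 1) := by
    have hcard : ((s.filter (fun b => -n₁ ≤ b ∧ b ≤ n₁)).card : ℝ) ≤ 2 * n₁ + 1 := by
      have h1 : s.filter (fun b => -n₁ ≤ b ∧ b ≤ n₁) ⊆ Finset.Icc (-n₁) n₁ := by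
        intro b hb
        rw [Finset.mem_filter] at hb
        rw [Finset.mem_Icc]; exact hb.2
      have h2 := Finset.card_le_card h1
      rw [Int.card_Icc] at h2
      have h3 : ((n₁ + 1 - -n₁).toNat : ℝ) = 2 * n₁ + 1 := by
        have : ((n₁ + 1 - -n₁).toNat : ℤ) = 2 * n₁ + 1 := by
          rw [Int.toNat_of_nonneg (by omega)]; ring
        exact_mod_cast this
      rw [← h3]; exact_mod_cast h2
    have hφ0 : 0 ≤ (2 * t + 3 * α) ^ 2 / (3 * α) + 1 := by positivity
    calc ∑ b ∈ s.filter (fun b => -n₁ ≤ b ∧ b ≤ n₁), G b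
        ≤ ∑ b ∈ s.filter (fun b => -n₁ ≤ b ∧ b ≤ n₁), ((2 * t + 3 * α) ^ 2 / (3 * α) + 1) := by
          refine Finset.sum_le_sum fun b hb => ?_
          rw [Finset.mem_filter] at hb
          exact hmid b hb.2.1 hb.2.2
      _ = (s.filter (fun b => -n₁ ≤ b ∧ b ≤ n₁)).card * ((2 * t + 3 * α) ^ 2 / (3 * α) + 1) := by
          rw [Finset.sum_const, nsmul_eq_mul]
      _ ≤ (2 * n₁ + 1) * ((2 * t + 3 * α) ^ 2 / (3 * α) + 1) := by gcongr
  -- assembling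
  have hnum := pairs_numerics (n₁ := (n₁ : ℝ)) (N := (Nb : ℝ)) hα1 hq1 hq2 hαq' ht1 htq ht3
    hn₁le (by exact_mod_cast hNb0) hNbq
  have hFK : ∑ i ∈ Finset.range K, F ((n₁ : ℝ) + 1 + i) ≤
      Nb * (3 * Nb + 3 * α + 1) + t ^ 2 / α + t ^ 3 / (3 * α) + t + t ^ 2 / 3 := hblock
  calc (S.ncard : ℝ) ≤ ∑ b ∈ s, G b := hfib
    _ = _ := hsplit
    _ ≤ 200 * r := by linarith [hL, hRt, hM, hFK, hnum]

end BinaryCubic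

end Literature.NumberTheory.CubicFields

end
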